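/-
Copyright (c) 2026 the pub-hodgecm-mathlib formalisation cell (harness21).  Prover seat hodgecm-mathlib-F0P3a-p04 (g31), 2026-09-03.  E1 row 41a «FIXED SET LOCALLY CONSTANT»
(E1 keeper ∕ dealer F0P3a-p03 (g29) 01:36:07Z; census «(SS-K) VIA THE RESOLUTION» v1 a09ddab6d77c6082 §3 (A11) ∕ §5 R-a).
-/
import Literature.Combinatorics.SimpleGraph.TreeAutomorphismFixedPoints   -- ★ `connected_induce_fixed` (Meier Lemma 3.50: the fixed set of a tree automorphism is connected)
import Literature.Combinatorics.SimpleGraph.ColoringNoEdgeInversion        -- ★ `forall_apply_eq_of_sym2Map_eq_of_coloring` (a colour-preserving map stabilising an edge fixes its ends)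
import HarnessLib

/-!
# The fixed set of a graph automorphism is LOCALLY CONSTANT: a second map that agrees with `φ` on `Fix(φ)` and on the neighbours of `Fix(φ)`, and whose own
# fixed set is connected, has the same fixed vertices (Schneider–Stuhler 1997, Lemma III.4.12; Korman 2004, Lemma 38) — and, for colour-preserving maps, the same fixed edges

Topic `Combinatorics/SimpleGraph`; namespace `Literature.Combinatorics.SimpleGraph.FixedSetLocallyConstant`.  THEOREMS ONLY (no definition, no instance, no notation,
no named fact, no `sorry`); any simple graph, no finiteness.  Cell `pub/hodgecm-mathlib` (D-0151), crux H413 = `stmt-HodgeConjecture-24833`, lane `--supports`; E1 row 41a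
of the E1 BRICK LEDGER (keeper F0P3a-p03 (g29)) = arrow (A11) of census «(SS-K) VIA THE RESOLUTION» (F0P3a-p04 (g31)): the one geometric input of Korman's Claim 39 ∕
Meyer–Solleveld's finite-`Σ` recipe for the Schneider–Stuhler character formula on elliptic elements, UNIFORM in the level `e`.  HONEST LABEL: count-neutral generic base
layer; HC_CM is proved only modulo the 2 remaining named inputs (hLiu418 24832, h413 24833) until rung 0 closes; nothing printed is asserted beyond what is proved.

THE MATHEMATICS.  [SS97, Lemma III.4.12, p. 142]: «for any given `h ∈ G^ell` there is an open subgroup `U ⊂ G` such that `X^{h′} = X^h` for any `h′ ∈ hU ∩ G^ell`» — proof: `X^h` is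
compact, contained in a ball `B(y, r)`, `U :=` the pointwise fixer of the ball; for `h′ ∈ hU`, `X^h ⊆ X^{h′}`, `X^{h′} ∖ X^h ⊆ {d(y, ·) > r}`, and «since with any `z ∈ X^{h′}` the whole
geodesic `[yz]` is contained in `X^{h′}` the latter inclusion forces `X^{h′} ∖ X^h` to be empty».  [Korman2004, Lemma 38] is the same statement and proof.  Here, for a TREE (or any graph
in which the new fixed set is known to be connected), the ball is replaced by the smallest witness: the fixed set `F = Fix(φ)` together with its NEIGHBOURS.  If `ψ` fixes `F`
pointwise and moves every neighbour of `F` that `φ` moves, and `Fix(ψ)` induces a connected subgraph, then `Fix(ψ) = F`: a walk inside `Fix(ψ)` from a new fixed vertex to `F`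
has a boundary dart `(a, b)` with `a ∉ F`, `b ∈ F` (Mathlib `SimpleGraph.Walk.exists_boundary_dart`); `a` is a `ψ`-fixed neighbour of `F` outside `F` — contradiction.  On a tree the
connectedness is automatic (★ `connected_induce_fixed`, Meier Lemma 3.50), so for automorphisms `φ, k` with `k = id` on `F ∪ N(F)`: `Fix(φk) = Fix(kφ) = Fix(φ)`; through a
homomorphism `a : Γ →* (G ≃g G)` this is «`X^{γk} = X^{kγ} = X^γ` for `k` in the finite intersection of the vertex stabilisers of `X^γ ∪ N(X^γ)`» — an OPEN subgroup as soon as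
`X^γ` is finite, the graph locally finite and stabilisers open (the consumer's bookkeeping, census R-c).  For maps preserving a proper colouring (type-preserving actions, no
inversions) equal fixed vertices give equal fixed EDGES (★ `forall_apply_eq_of_sym2Map_eq_of_coloring`).

* §1 ANY GRAPH: `setOf_apply_eq_eq_of_preconnected` (hypotheses: `ψ` fixes `Fix φ`; `ψ` moves the `φ`-moved neighbours of `Fix φ`; `Fix ψ` induces a preconnected subgraph;
  `Fix φ ≠ ∅`), `setOf_apply_eq_eq_of_agree` (hypothesis «`ψ = φ` on `Fix φ ∪ N(Fix φ)`»).
* §2 TREES (`G.IsTree`, `ψ : G ≃g G`): `setOf_apply_eq_eq_of_isTree`, `setOf_apply_eq_eq_of_isTree_of_agree`.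
* §3 PERTURBATIONS (Korman's `γk`, `γ′ ∈ γU`): `setOf_mul_apply_eq_eq` (`Fix(φ * k) = Fix φ`), `setOf_mul_apply_eq_eq'` (`Fix(k * φ) = Fix φ`), and through `a : Γ →* (G ≃g G)`:
  `setOf_map_mul_apply_eq_eq`, `setOf_map_mul_apply_eq_eq'`.
* §4 EDGES under a colouring: `mapEdgeSet_eq_self_of_forall_apply_eq`, `mapEdgeSet_eq_self_iff_of_coloring`, `setOf_mapEdgeSet_eq_eq_of_coloring` (equal fixed vertices ⇒ equal fixed
  edges), `setOf_mapEdgeSet_mul_eq_eq_of_coloring` (the edge companion of §3).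

## References
* [SchneiderStuhler1997] P. Schneider, U. Stuhler, *Representation theory and sheaves on the Bruhat–Tits building*, Publ. Math. IHÉS 85 (1997): Lemma III.4.12 p. 142 (held
  `paper:doi-10-1007-bf02699536` p0047).
* [Korman2004] J. Korman, *A character formula for compact elements (the rank one case)*, arXiv:math/0409292: Lemma 38, Claim 39 (held `paper:arxiv-math_0409292` p0021).
* [Meier2008] J. Meier, *Groups, Graphs and Trees*, LMS Student Texts 73 (2008): Lemma 3.50 (fixed sets in trees are subtrees), Corollary 3.47 (colour-preserving ⇒ no inversion).
* [Serre1980Trees] J.-P. Serre, *Trees* (1980): I.2.3 (geodesics), I.3.1 (inversions), I.6.1.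
-/

set_option autoImplicit false

open Set SimpleGraph

namespace Literature.Combinatorics.SimpleGraph.FixedSetLocallyConstant

open Literature.Combinatorics.SimpleGraph.BakerNorine Literature.Combinatorics.SimpleGraph.NoInversion

variable {V : Type*} {G : SimpleGraph V}

/-! ## §1 Any graph: agreement on `Fix φ ∪ N(Fix φ)` + connected new fixed set ⇒ same fixed set -/

/-- **THE FIXED SET IS LOCALLY CONSTANT (abstract form).**  Let `φ ψ : V → V`.  If `ψ` fixes every `φ`-fixed vertex, `ψ` moves every neighbour of a `φ`-fixed vertex that `φ`
moves, the `ψ`-fixed vertices induce a preconnected subgraph of `G`, and `φ` fixes some vertex, then `ψ` and `φ` have the same fixed vertices: a walk inside `Fix ψ` from a new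
fixed vertex to `Fix φ` would cross the boundary of `Fix φ` at a `ψ`-fixed neighbour. [cite: SchneiderStuhler1997, Lemma III.4.12 p. 142] [cite: Korman2004, Lemma 38] -/
theorem setOf_apply_eq_eq_of_preconnected (φ ψ : V → V) (hF : ∀ v, φ v = v → ψ v = v)
    (hN : ∀ v w, φ v = v → G.Adj v w → φ w ≠ w → ψ w ≠ w) (hconn : (G.induce {v | ψ v = v}).Preconnected) (hne : ∃ v, φ v = v) :
    {v | ψ v = v} = {v | φ v = v} := by
  ext y
  refine ⟨fun hy => ?_, fun hy => hF y hy⟩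
  by_contra hyF
  obtain ⟨x₀, hx₀⟩ := hne
  -- a walk inside `Fix ψ` from `y` to `x₀`, pushed into `G`
  obtain ⟨q⟩ := hconn ⟨y, hy⟩ ⟨x₀, hF x₀ hx₀⟩
  have hsupp : ∀ w ∈ (q.map (Embedding.induce {v | ψ v = v}).toHom).support, ψ w = w := by
    intro w hw
    rw [Walk.support_map, List.mem_map] at hw
    obtain ⟨z, -, rfl⟩ := hw
    exact z.2
  -- its boundary dart with respect to the complement of `Fix φ`
  obtain ⟨d, hd, hd1, hd2⟩ :=
    (q.map (Embedding.induce {v | ψ v = v}).toHom).exists_boundary_dart {v | φ v = v}ᶜ hyF (fun h => h hx₀)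
  have hφ2 : φ d.snd = d.snd := not_not.1 hd2
  exact hN d.snd d.fst hφ2 d.adj.symm hd1 (hsupp _ (Walk.dart_fst_mem_support_of_mem_darts _ hd))

/-- **THE FIXED SET IS LOCALLY CONSTANT (agreement form).**  If `ψ = φ` on `Fix φ` and on all neighbours of `Fix φ`, the `ψ`-fixed vertices induce a preconnected subgraph and
`Fix φ ≠ ∅`, then `Fix ψ = Fix φ`. [cite: SchneiderStuhler1997, Lemma III.4.12 p. 142] [cite: Korman2004, Lemma 38] -/
theorem setOf_apply_eq_eq_of_agree (φ ψ : V → V) (hagree : ∀ v w, φ v = v → (w = v ∨ G.Adj v w) → ψ w = φ w)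
    (hconn : (G.induce {v | ψ v = v}).Preconnected) (hne : ∃ v, φ v = v) : {v | ψ v = v} = {v | φ v = v} :=
  setOf_apply_eq_eq_of_preconnected φ ψ (fun v hv => (hagree v v hv (Or.inl rfl)).trans hv)
    (fun v w hv hvw hw => by rw [hagree v w hv (Or.inr hvw)]; exact hw) hconn hne

/-! ## §2 Trees: the connectedness of `Fix ψ` is automatic for an automorphism -/

/-- **LOCALLY CONSTANT FIXED SETS ON A TREE.**  `G` a tree, `ψ : G ≃g G`; if `ψ` fixes `Fix φ`, moves the `φ`-moved neighbours of `Fix φ`, and `Fix φ ≠ ∅`, then `Fix ψ = Fix φ`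
(★ `connected_induce_fixed`: the fixed set of a tree automorphism with a fixed vertex is connected, Meier Lemma 3.50). [cite: SchneiderStuhler1997, Lemma III.4.12 p. 142]
[cite: Korman2004, Lemma 38] [cite: Meier2008, Lemma 3.50] -/
theorem setOf_apply_eq_eq_of_isTree (hT : G.IsTree) (φ : V → V) (ψ : G ≃g G) (hF : ∀ v, φ v = v → ψ v = v)
    (hN : ∀ v w, φ v = v → G.Adj v w → φ w ≠ w → ψ w ≠ w) (hne : ∃ v, φ v = v) : {v | ψ v = v} = {v | φ v = v} := by
  obtain ⟨u, hu⟩ := hne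
  exact setOf_apply_eq_eq_of_preconnected φ ψ hF hN (connected_induce_fixed hT ψ (hF u hu)).preconnected ⟨u, hu⟩

/-- **LOCALLY CONSTANT FIXED SETS ON A TREE (agreement form).**  `G` a tree, `ψ : G ≃g G` with `ψ = φ` on `Fix φ ∪ N(Fix φ)`, `Fix φ ≠ ∅` ⇒ `Fix ψ = Fix φ`.
[cite: SchneiderStuhler1997, Lemma III.4.12 p. 142] [cite: Korman2004, Lemma 38] [cite: Meier2008, Lemma 3.50] -/
theorem setOf_apply_eq_eq_of_isTree_of_agree (hT : G.IsTree) (φ : V → V) (ψ : G ≃g G) (hagree : ∀ v w, φ v = v → (w = v ∨ G.Adj v w) → ψ w = φ w)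
    (hne : ∃ v, φ v = v) : {v | ψ v = v} = {v | φ v = v} := by
  obtain ⟨u, hu⟩ := hne
  exact setOf_apply_eq_eq_of_agree φ ψ hagree (connected_induce_fixed hT ψ ((hagree u u hu (Or.inl rfl)).trans hu)).preconnected ⟨u, hu⟩

/-! ## §3 Perturbations `φk` and `kφ` by an automorphism `k` trivial on `Fix φ ∪ N(Fix φ)` (Korman's `γ′ = γk ∈ γU`) -/

/-- **`Fix(φk) = Fix φ`** on a tree, for automorphisms `φ, k` with `k` the identity on `Fix φ` and on the neighbours of `Fix φ`, `Fix φ ≠ ∅` («all elements `γk`, `k ∈ K`, have the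
same fixed point set: `X^γ = X^{γk}`»). [cite: Korman2004, Lemma 38, Claim 39] [cite: SchneiderStuhler1997, Lemma III.4.12 p. 142] -/
theorem setOf_mul_apply_eq_eq (hT : G.IsTree) (φ k : G ≃g G) (hne : ∃ v, φ v = v) (hkF : ∀ v, φ v = v → k v = v)
    (hkN : ∀ v w, φ v = v → G.Adj v w → k w = w) : {v | (φ * k) v = v} = {v | φ v = v} := by
  refine setOf_apply_eq_eq_of_isTree hT φ (φ * k) (fun v hv => ?_) (fun v w hv hvw hw => ?_) hne
  · rw [RelIso.coe_mul, Function.comp_apply, hkF v hv, hv]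
  · rwa [RelIso.coe_mul, Function.comp_apply, hkN v w hv hvw]

/-- **`Fix(kφ) = Fix φ`** on a tree, for automorphisms `φ, k` with `k` the identity on `Fix φ` and on the neighbours of `Fix φ`, `Fix φ ≠ ∅` (the left-handed twin: `φ` maps a
neighbour `w` of a fixed `v` to a neighbour `φ w` of `φ v = v`, where `k` is trivial). [cite: Korman2004, Lemma 38, Claim 39] [cite: SchneiderStuhler1997, Lemma III.4.12 p. 142] -/
theorem setOf_mul_apply_eq_eq' (hT : G.IsTree) (φ k : G ≃g G) (hne : ∃ v, φ v = v) (hkF : ∀ v, φ v = v → k v = v)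
    (hkN : ∀ v w, φ v = v → G.Adj v w → k w = w) : {v | (k * φ) v = v} = {v | φ v = v} := by
  refine setOf_apply_eq_eq_of_isTree hT φ (k * φ) (fun v hv => ?_) (fun v w hv hvw hw => ?_) hne
  · rw [RelIso.coe_mul, Function.comp_apply, hv, hkF v hv]
  · have hadj : G.Adj v (φ w) := by
      have h := (φ.map_rel_iff (a := v) (b := w)).2 hvw
      rwa [hv] at h
    rwa [RelIso.coe_mul, Function.comp_apply, hkN v (φ w) hv hadj]

section Hom

variable {Γ : Type*} [Group Γ] (a : Γ →* (G ≃g G))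

/-- **`X^{γk} = X^γ`** through an action `a : Γ →* (G ≃g G)` on a tree, for `k` acting trivially on `X^γ` and on its neighbours, `X^γ ≠ ∅`. [cite: Korman2004, Lemma 38, Claim 39]
[cite: SchneiderStuhler1997, Lemma III.4.12 p. 142] -/
theorem setOf_map_mul_apply_eq_eq (hT : G.IsTree) (γ k : Γ) (hne : ∃ v, a γ v = v) (hkF : ∀ v, a γ v = v → a k v = v)
    (hkN : ∀ v w, a γ v = v → G.Adj v w → a k w = w) : {v | a (γ * k) v = v} = {v | a γ v = v} := by
  rw [map_mul]
  exact setOf_mul_apply_eq_eq hT (a γ) (a k) hne hkF hkN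

/-- **`X^{kγ} = X^γ`** through an action `a : Γ →* (G ≃g G)` on a tree, for `k` acting trivially on `X^γ` and on its neighbours, `X^γ ≠ ∅`. [cite: Korman2004, Lemma 38, Claim 39]
[cite: SchneiderStuhler1997, Lemma III.4.12 p. 142] -/
theorem setOf_map_mul_apply_eq_eq' (hT : G.IsTree) (γ k : Γ) (hne : ∃ v, a γ v = v) (hkF : ∀ v, a γ v = v → a k v = v)
    (hkN : ∀ v w, a γ v = v → G.Adj v w → a k w = w) : {v | a (k * γ) v = v} = {v | a γ v = v} := by
  rw [map_mul]
  exact setOf_mul_apply_eq_eq' hT (a γ) (a k) hne hkF hkN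

end Hom

/-! ## §4 Edges: under a preserved proper colouring, equal fixed vertices give equal fixed edges -/

section Edges

variable {ι : Type*}

/-- A homomorphism fixing both ends of an edge fixes the edge. [cite: Serre1980Trees, I.3.1] -/
theorem mapEdgeSet_eq_self_of_forall_apply_eq (f : G →g G) {e : G.edgeSet} (h : ∀ v ∈ (e : Sym2 V), f v = v) : f.mapEdgeSet e = e := by
  apply Subtype.ext
  rw [Hom.mapEdgeSet_coe]
  obtain ⟨e, he⟩ := e
  induction e using Sym2.ind with
  | h x y => rw [Sym2.map_mk, h x (Sym2.mem_mk_left x y), h y (Sym2.mem_mk_right x y)]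

/-- For a colour-preserving homomorphism: `f·e = e ↔ f` fixes both ends of `e` (no inversions). [cite: Meier2008, Corollary 3.47] [cite: Serre1980Trees, I.3.1] -/
theorem mapEdgeSet_eq_self_iff_of_coloring (C : G.Coloring ι) (f : G →g G) (hC : ∀ v, C (f v) = C v) (e : G.edgeSet) :
    f.mapEdgeSet e = e ↔ ∀ v ∈ (e : Sym2 V), f v = v :=
  ⟨apply_eq_of_mapEdgeSet_eq_of_coloring C f hC, mapEdgeSet_eq_self_of_forall_apply_eq f⟩

/-- **EQUAL FIXED VERTICES ⇒ EQUAL FIXED EDGES** for two colour-preserving homomorphisms. [cite: Meier2008, Corollary 3.47] [cite: SchneiderStuhler1997, Lemma III.4.12 p. 142] -/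
theorem setOf_mapEdgeSet_eq_eq_of_coloring (C : G.Coloring ι) (f g : G →g G) (hf : ∀ v, C (f v) = C v) (hg : ∀ v, C (g v) = C v)
    (h : {v | g v = v} = {v | f v = v}) : {e : G.edgeSet | g.mapEdgeSet e = e} = {e | f.mapEdgeSet e = e} := by
  ext e
  simp only [mem_setOf_eq, mapEdgeSet_eq_self_iff_of_coloring C g hg, mapEdgeSet_eq_self_iff_of_coloring C f hf]
  have hv : ∀ v, g v = v ↔ f v = v := fun v => Set.ext_iff.1 h v
  exact forall₂_congr fun v _ => hv v

variable {Γ : Type*} [Group Γ] (a : Γ →* (G ≃g G))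

/-- **`(X^{γk})₁ = (X^γ)₁` — the fixed EDGES too**: through a colour-preserving action on a tree, for `k` acting trivially on `X^γ` and on its neighbours, `X^γ ≠ ∅`.
[cite: Korman2004, Lemma 38, Claim 39] [cite: SchneiderStuhler1997, Lemma III.4.12 p. 142] [cite: Meier2008, Corollary 3.47] -/
theorem setOf_mapEdgeSet_mul_eq_eq_of_coloring (hT : G.IsTree) (C : G.Coloring ι) (hC : ∀ (g : Γ) v, C (a g v) = C v) (γ k : Γ) (hne : ∃ v, a γ v = v)
    (hkF : ∀ v, a γ v = v → a k v = v) (hkN : ∀ v w, a γ v = v → G.Adj v w → a k w = w) :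
    {e : G.edgeSet | (a (γ * k)).mapEdgeSet e = e} = {e | (a γ).mapEdgeSet e = e} := by
  have h := setOf_mapEdgeSet_eq_eq_of_coloring C (a γ : G →g G) (a (γ * k) : G →g G) (hC γ) (hC (γ * k)) (setOf_map_mul_apply_eq_eq a hT γ k hne hkF hkN)
  ext e
  have he := Set.ext_iff.1 h e
  simp only [mem_setOf_eq, Iso.mapEdgeSet_apply] at he ⊢
  exact he

end Edges

end Literature.Combinatorics.SimpleGraph.FixedSetLocallyConstant
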